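import Summits.CriticalPhenomena.PercolationContinuityZ3.Theorems.Transplant.FKThreeApexT5
import HarnessLib

/-!
# Connectivity correlation inequalities for `φ_{w,q}`, `0 < q ≤ 1` — the three-apex monoid: the UPPER-ENVELOPE SET `Ω_q` (layer 1 of the
# semigroup theorem behind `(U_a)`): hat coordinates, the product identities, letters lie in `Ω_q`

Helper file (`--supports stmt-CriticalPhenomena-4575`), FK sub-lane `prim-bschramm-fk-3` (gen 14); builds on p205010 (kernel theorem, internal audit
signed; external expert review pending).  Pure real algebra, no sorries; standard axioms.  Memo `bschramm/prim-bschramm-fk-3/DISJOINT-VIA-U.md` §1–2.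

In the character ("hat") coordinates `(u,x,y,z,v) = (Z_0, Z_0+Z_ab, Z_0+Z_ac, Z_0+Z_bc, ΣZ)` the letter maps `ThreeApex.conv` act coordinatewise
(`hat_conv`), and the forms entering `(U_a)` — `N^{(ab)} = xv + (1−q)yz − (2−q)uv`, `N^{(ac)}`, `M_a = (x+y−(2−q)u)(v−z)` — are bilinear in
`(u,x,y) ⊗ (z,v)`.  `ThreeApex.InOmega q Z` is the semialgebraic set `Ω_q` of the memo written homogeneously: `u > 0`, `z > 0`, `x,y ≥ u`, the `(S)`
inequalities `xz ≤ uv`, `yz ≤ uv`, the two master inequalities, and the square-root-free `(U_a)`: `∀ w₁ w₂ ≥ 0, uForm q w₁ w₂ Z ≥ 0`.  The SEMIGROUP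
THEOREM (memo §2: `Ω_q` is closed under `conv`; computer-certified) gives `(U_a)` on the whole monoid; this file is its first layer:
* `hat_conv`, and the PRODUCT IDENTITIES `Nab_conv`, `Nac_conv` (`N(z·Z) = u'v' N(Z) + uv N(z) + (x−u)(x'−u')vv' + (1−q)(uv−yz)(u'v'−y'z')`,
  manifestly preserving `N ≥ 0` — the master inequality for PRODUCTS, not only for letters) and `InOmega.conv_basic` (all fields of `Ω` except
  `(U_a)` are preserved by `conv`);
* **`uForm_nonneg_of_sq`**: `4 N^{(ab)} N^{(ac)} ≥ (2−q)² J_a²` with `N ≥ 0` implies `Φ_a(w₁,w₂) ≥ 0` for ALL real weights (so `(U_a)`);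
* **`IsLetter.uForm_nonneg`**: every letter satisfies `(U_a)` — for the leaf `(α,β,γ)` via the exact factorisation
  `4N^{(ab)}N^{(ac)} − (2−q)²J_a² = α²βγ(1−β)(1−γ)(α+q(1−α))²·Pos`, `Pos = (2q−(2−q)βγ)² + q(4−q)βγ + 4q(1−q)(β+γ) + (2−q)²βγ(β(1−γ)+γ(1−β))`;
* `IsLetter.inOmega`: letters with `Z_0 > 0` lie in `Ω_q`.
[cite: Grimmett2006, §3.9 eq. (3.94) (pp. 63–64)] [folklore]
-/

noncomputable section

namespace Summit.CriticalPhenomena.PercolationContinuityZ3.Theorems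

namespace FK

namespace ThreeApex

/-! ### Hat coordinates -/

/-- `x̂ = Z_0 + Z_ab` (mass of partitions `≤ ab|c`). [folklore] -/
def hx (Z : V5) : ℝ := Z.z0 + Z.zab
/-- `ŷ = Z_0 + Z_ac`. [folklore] -/
def hy (Z : V5) : ℝ := Z.z0 + Z.zac
/-- `ẑ = Z_0 + Z_bc`. [folklore] -/
def hz (Z : V5) : ℝ := Z.z0 + Z.zbc

/-- `conv` is coordinatewise multiplication in hat coordinates. [folklore] -/
theorem hat_conv (z Z : V5) :
    (conv z Z).z0 = z.z0 * Z.z0 ∧ hx (conv z Z) = hx z * hx Z ∧ hy (conv z Z) = hy z * hy Z ∧ hz (conv z Z) = hz z * hz Z ∧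
      (conv z Z).total = z.total * Z.total := by
  refine ⟨rfl, ?_, ?_, ?_, ?_⟩ <;> simp only [conv, hx, hy, hz, V5.total] <;> ring

/-- The master form `N^{(ab)}` in hat coordinates. [folklore] -/
theorem masterNab_hat (q : ℝ) (Z : V5) :
    masterN q (swapBC Z) = hx Z * Z.total + (1 - q) * hy Z * hz Z - (2 - q) * Z.z0 * Z.total := by
  simp only [masterN, swapBC, hx, hy, hz, V5.total]; ring

/-- The master form `N^{(ac)}` in hat coordinates. [folklore] -/
theorem masterN_hat (q : ℝ) (Z : V5) :
    masterN q Z = hy Z * Z.total + (1 - q) * hx Z * hz Z - (2 - q) * Z.z0 * Z.total := by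
  simp only [masterN, hx, hy, hz, V5.total]; ring

/-- `M_a` in hat coordinates: `(x̂ + ŷ − (2−q)û)(v̂ − ẑ)`. [folklore] -/
theorem massA_hat (q : ℝ) (Z : V5) : massA q Z = (hx Z + hy Z - (2 - q) * Z.z0) * (Z.total - hz Z) := by
  simp only [massA, hx, hy, hz, V5.total]; ring

/-- The `a`-side Harris defect `J_a = ẑ(x̂+ŷ−û) − ûv̂`; one has `N^{(ab)} + N^{(ac)} − M_a = (2−q) J_a`. [folklore] -/
def jA (Z : V5) : ℝ := hz Z * (hx Z + hy Z - Z.z0) - Z.z0 * Z.total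

/-- `N^{(ab)} + N^{(ac)} − M_a = (2−q)·J_a`. [folklore] -/
theorem masterN_add_sub_massA (q : ℝ) (Z : V5) : masterN q (swapBC Z) + masterN q Z - massA q Z = (2 - q) * jA Z := by
  simp only [masterN, swapBC, massA, jA, hx, hy, hz, V5.total]; ring

/-! ### Product identities: the master inequality is preserved by ALL products -/

/-- **Product identity for `N^{(ab)}`.** [folklore] -/
theorem masterNab_conv (q : ℝ) (z Z : V5) :
    masterN q (swapBC (conv z Z)) = z.z0 * z.total * masterN q (swapBC Z) + Z.z0 * Z.total * masterN q (swapBC z)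
      + (hx z - z.z0) * (hx Z - Z.z0) * z.total * Z.total
      + (1 - q) * (z.z0 * z.total - hy z * hz z) * (Z.z0 * Z.total - hy Z * hz Z) := by
  simp only [masterN, swapBC, conv, hx, hy, hz, V5.total]; ring

/-- **Product identity for `N^{(ac)}`.** [folklore] -/
theorem masterNac_conv (q : ℝ) (z Z : V5) :
    masterN q (conv z Z) = z.z0 * z.total * masterN q Z + Z.z0 * Z.total * masterN q z
      + (hy z - z.z0) * (hy Z - Z.z0) * z.total * Z.total
      + (1 - q) * (z.z0 * z.total - hx z * hz z) * (Z.z0 * Z.total - hx Z * hz Z) := by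
  simp only [masterN, conv, hx, hy, hz, V5.total]; ring

/-! ### The set `Ω_q` -/

/-- The set `Ω_q` of the memo in homogeneous hat coordinates (positivity, `(S)`, master inequalities, `(U_a)`). [folklore] -/
structure InOmega (q : ℝ) (Z : V5) : Prop where
  /-- `û > 0` -/
  u_pos : 0 < Z.z0
  /-- `ẑ > 0` -/
  z_pos : 0 < hz Z
  /-- `x̂ ≥ û` -/
  x_ge : Z.z0 ≤ hx Z
  /-- `ŷ ≥ û` -/
  y_ge : Z.z0 ≤ hy Z
  /-- `(S)`: `x̂ẑ ≤ ûv̂` -/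
  sxz : hx Z * hz Z ≤ Z.z0 * Z.total
  /-- `(S)`: `ŷẑ ≤ ûv̂` -/
  syz : hy Z * hz Z ≤ Z.z0 * Z.total
  /-- `N^{(ab)} ≥ 0` -/
  nab : 0 ≤ masterN q (swapBC Z)
  /-- `N^{(ac)} ≥ 0` -/
  nac : 0 ≤ masterN q Z
  /-- `(U_a)`: `Φ_a(w₁,w₂) ≥ 0` for all `w₁, w₂ ≥ 0` -/
  U : ∀ w₁ w₂ : ℝ, 0 ≤ w₁ → 0 ≤ w₂ → 0 ≤ uForm q w₁ w₂ Z

/-- `v̂ > 0` on `Ω_q`. [folklore] -/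
theorem InOmega.total_pos {q : ℝ} {Z : V5} (h : InOmega q Z) : 0 < Z.total := by
  have h1 : hx Z * hz Z ≤ Z.z0 * Z.total := h.sxz
  have h2 : 0 < hx Z * hz Z := mul_pos (lt_of_lt_of_le h.u_pos h.x_ge) h.z_pos
  nlinarith [h.u_pos]

/-- All fields of `Ω_q` except `(U_a)` are preserved by `conv` (`0 ≤ q ≤ 1`). [folklore] -/
theorem InOmega.conv_basic {q : ℝ} (hq1 : q ≤ 1) {z Z : V5} (hz' : InOmega q z) (hZ : InOmega q Z) :
    0 < (conv z Z).z0 ∧ 0 < hz (conv z Z) ∧ (conv z Z).z0 ≤ hx (conv z Z) ∧ (conv z Z).z0 ≤ hy (conv z Z) ∧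
      hx (conv z Z) * hz (conv z Z) ≤ (conv z Z).z0 * (conv z Z).total ∧ hy (conv z Z) * hz (conv z Z) ≤ (conv z Z).z0 * (conv z Z).total ∧
      0 ≤ masterN q (swapBC (conv z Z)) ∧ 0 ≤ masterN q (conv z Z) := by
  obtain ⟨h0, h1, h2, h3, h4⟩ := hat_conv z Z
  have hq' : 0 ≤ 1 - q := sub_nonneg.2 hq1
  have tz := hz'.total_pos; have tZ := hZ.total_pos
  refine ⟨?_, ?_, ?_, ?_, ?_, ?_, ?_, ?_⟩
  · rw [h0]; exact mul_pos hz'.u_pos hZ.u_pos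
  · rw [h3]; exact mul_pos hz'.z_pos hZ.z_pos
  · rw [h0, h1]; exact mul_le_mul hz'.x_ge hZ.x_ge hZ.u_pos.le (le_trans hz'.u_pos.le hz'.x_ge)
  · rw [h0, h2]; exact mul_le_mul hz'.y_ge hZ.y_ge hZ.u_pos.le (le_trans hz'.u_pos.le hz'.y_ge)
  · rw [h0, h1, h3, h4]
    have := mul_le_mul hz'.sxz hZ.sxz (by nlinarith [hZ.u_pos, hZ.x_ge, hZ.z_pos]) (by nlinarith [hz'.u_pos, tz])
    nlinarith [this]
  · rw [h0, h2, h3, h4]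
    have := mul_le_mul hz'.syz hZ.syz (by nlinarith [hZ.u_pos, hZ.y_ge, hZ.z_pos]) (by nlinarith [hz'.u_pos, tz])
    nlinarith [this]
  · rw [masterNab_conv]
    have a1 : 0 ≤ z.z0 * z.total * masterN q (swapBC Z) := by have := hz'.u_pos; have := hZ.nab; positivity
    have a2 : 0 ≤ Z.z0 * Z.total * masterN q (swapBC z) := by have := hZ.u_pos; have := hz'.nab; positivity
    have a3 : 0 ≤ (hx z - z.z0) * (hx Z - Z.z0) * z.total * Z.total := by
      have := sub_nonneg.2 hz'.x_ge; have := sub_nonneg.2 hZ.x_ge; positivity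
    have a4 : 0 ≤ (1 - q) * (z.z0 * z.total - hy z * hz z) * (Z.z0 * Z.total - hy Z * hz Z) := by
      have := sub_nonneg.2 hz'.syz; have := sub_nonneg.2 hZ.syz; positivity
    linarith
  · rw [masterNac_conv]
    have a1 : 0 ≤ z.z0 * z.total * masterN q Z := by have := hz'.u_pos; have := hZ.nac; positivity
    have a2 : 0 ≤ Z.z0 * Z.total * masterN q z := by have := hZ.u_pos; have := hz'.nac; positivity
    have a3 : 0 ≤ (hy z - z.z0) * (hy Z - Z.z0) * z.total * Z.total := by
      have := sub_nonneg.2 hz'.y_ge; have := sub_nonneg.2 hZ.y_ge; positivity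
    have a4 : 0 ≤ (1 - q) * (z.z0 * z.total - hx z * hz z) * (Z.z0 * Z.total - hx Z * hz Z) := by
      have := sub_nonneg.2 hz'.sxz; have := sub_nonneg.2 hZ.sxz; positivity
    linarith

/-! ### Copositivity: the determinant condition implies `(U_a)` -/

/-- `Φ_a` as a quadratic form in the weights. [folklore] -/
theorem uForm_eq (q w₁ w₂ : ℝ) (Z : V5) :
    uForm q w₁ w₂ Z = w₁ ^ 2 * masterN q (swapBC Z) + w₂ ^ 2 * masterN q Z + w₁ * w₂ * ((2 - q) * jA Z) := by
  rw [← masterN_add_sub_massA]; simp only [uForm]; ring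

/-- **Copositivity.** If `N^{(ab)}, N^{(ac)} ≥ 0` and `4 N^{(ab)} N^{(ac)} ≥ (2−q)² J_a²`, then `Φ_a(w₁,w₂) ≥ 0` (for all real `w₁,w₂`). [folklore] -/
theorem uForm_nonneg_of_sq {q : ℝ} {Z : V5} (h1 : 0 ≤ masterN q (swapBC Z)) (h2 : 0 ≤ masterN q Z)
    (hdet : ((2 - q) * jA Z) ^ 2 ≤ 4 * masterN q (swapBC Z) * masterN q Z) (w₁ w₂ : ℝ) :
    0 ≤ uForm q w₁ w₂ Z := by
  rw [uForm_eq]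
  set N₁ := masterN q (swapBC Z)
  set N₂ := masterN q Z
  set K := (2 - q) * jA Z
  -- `w₁² N₁ + w₂² N₂ ≥ w₁ w₂ |K|` since its square dominates `(w₁ w₂ K)²`.
  have hP : 0 ≤ w₁ ^ 2 * N₁ + w₂ ^ 2 * N₂ := by positivity
  have hsq : (w₁ * w₂ * K) ^ 2 ≤ (w₁ ^ 2 * N₁ + w₂ ^ 2 * N₂) ^ 2 := by
    have e : (w₁ ^ 2 * N₁ + w₂ ^ 2 * N₂) ^ 2 = (w₁ ^ 2 * N₁ - w₂ ^ 2 * N₂) ^ 2 + w₁ ^ 2 * w₂ ^ 2 * (4 * N₁ * N₂) := by ring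
    have e2 : (w₁ * w₂ * K) ^ 2 = w₁ ^ 2 * w₂ ^ 2 * K ^ 2 := by ring
    rw [e, e2]
    have : w₁ ^ 2 * w₂ ^ 2 * K ^ 2 ≤ w₁ ^ 2 * w₂ ^ 2 * (4 * N₁ * N₂) := mul_le_mul_of_nonneg_left hdet (by positivity)
    nlinarith [sq_nonneg (w₁ ^ 2 * N₁ - w₂ ^ 2 * N₂)]
  have habs : |w₁ * w₂ * K| ≤ w₁ ^ 2 * N₁ + w₂ ^ 2 * N₂ := abs_le_of_sq_le_sq' hsq hP |>.2 |> fun h => by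
    exact abs_le.2 ⟨by linarith [(abs_le_of_sq_le_sq' hsq hP).1], h⟩
  have : -(w₁ * w₂ * K) ≤ w₁ ^ 2 * N₁ + w₂ ^ 2 * N₂ := by linarith [neg_abs_le (w₁ * w₂ * K), habs]
  linarith

/-! ### Letters lie in `Ω_q` -/

/-- The `a`-independent positive factor of the leaf determinant (memo §2):
`Pos = (2q−(2−q)βγ)² + q(4−q)βγ + 4q(1−q)(β+γ) + (2−q)²βγ(β(1−γ)+γ(1−β))`. [folklore] -/
def leafPos (q b c : ℝ) : ℝ :=
  (2 * q - (2 - q) * b * c) ^ 2 + q * (4 - q) * b * c + 4 * q * (1 - q) * (b + c) + (2 - q) ^ 2 * b * c * (b * (1 - c) + c * (1 - b))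

/-- `Pos ≥ 0` for `0 ≤ q ≤ 1`, `b, c ∈ [0,1]`. [folklore] -/
theorem leafPos_nonneg {q b c : ℝ} (hq0 : 0 ≤ q) (hq1 : q ≤ 1) (hb0 : 0 ≤ b) (hb1 : b ≤ 1) (hc0 : 0 ≤ c) (hc1 : c ≤ 1) :
    0 ≤ leafPos q b c := by
  have : 0 ≤ 1 - q := sub_nonneg.2 hq1
  have : 0 ≤ 4 - q := by linarith
  have : 0 ≤ 1 - b := sub_nonneg.2 hb1
  have : 0 ≤ 1 - c := sub_nonneg.2 hc1
  unfold leafPos; positivity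

/-- **Leaf determinant factorisation.** `4N^{(ab)}N^{(ac)} − (2−q)²J_a² = α²βγ(1−β)(1−γ)(α+q(1−α))²·Pos` for the leaf letter. [folklore] -/
theorem leaf_det_eq (q a b c : ℝ) :
    4 * masterN q (swapBC (leaf q a b c)) * masterN q (leaf q a b c) - ((2 - q) * jA (leaf q a b c)) ^ 2 =
      a ^ 2 * b * c * (1 - b) * (1 - c) * (a + q * (1 - a)) ^ 2 * leafPos q b c := by
  simp only [masterN, swapBC, leaf, jA, hx, hy, hz, V5.total, leafPos]; ring

/-- **`(U_a)` for every letter.** [folklore] -/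
theorem IsLetter.uForm_nonneg {q : ℝ} (hq0 : 0 ≤ q) (hq1 : q ≤ 1) {z : V5} (h : IsLetter q z) (w₁ w₂ : ℝ) :
    0 ≤ uForm q w₁ w₂ z := by
  have hN2 : 0 ≤ masterN q z := h.masterN_nonneg hq0 hq1
  have hN1 : 0 ≤ masterN q (ThreeApex.swapBC z) := h.swapBC.masterN_nonneg hq0 hq1
  refine uForm_nonneg_of_sq hN1 hN2 ?_ w₁ w₂
  rcases h with ⟨ha0, ha1, hb0, hb1, hc0, hc1⟩ | ⟨hw0, hw1⟩ | ⟨hw0, hw1⟩ | ⟨hw0, hw1⟩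
  · rename_i a b c
    have e := leaf_det_eq q a b c
    have hpos : 0 ≤ leafPos q b c := leafPos_nonneg hq0 hq1 hb0 hb1 hc0 hc1
    have hb' : 0 ≤ 1 - b := sub_nonneg.2 hb1
    have hc' : 0 ≤ 1 - c := sub_nonneg.2 hc1
    have hr : 0 ≤ a ^ 2 * b * c * (1 - b) * (1 - c) * (a + q * (1 - a)) ^ 2 * leafPos q b c := by positivity
    linarith
  · rename_i w
    have e : jA (ThreeApex.edgeAB w) = 0 := by simp only [jA, ThreeApex.edgeAB, hx, hy, hz, V5.total]; ring
    rw [e, mul_zero, zero_pow two_ne_zero]; positivity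
  · rename_i w
    have e : jA (ThreeApex.edgeAC w) = 0 := by simp only [jA, ThreeApex.edgeAC, hx, hy, hz, V5.total]; ring
    rw [e, mul_zero, zero_pow two_ne_zero]; positivity
  · rename_i w
    have e : jA (ThreeApex.edgeBC w) = 0 := by simp only [jA, ThreeApex.edgeBC, hx, hy, hz, V5.total]; ring
    rw [e, mul_zero, zero_pow two_ne_zero]; positivity

/-- Letters with `Z_0 > 0` lie in `Ω_q`. [folklore] -/
theorem IsLetter.inOmega {q : ℝ} (hq0 : 0 ≤ q) (hq1 : q ≤ 1) {z : V5} (h : IsLetter q z) (hu : 0 < z.z0) : InOmega q z := by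
  have hnn := h.nonneg hq0
  have hU : ∀ w₁ w₂ : ℝ, 0 ≤ w₁ → 0 ≤ w₂ → 0 ≤ uForm q w₁ w₂ z := fun w₁ w₂ _ _ => h.uForm_nonneg hq0 hq1 w₁ w₂
  have hNab : 0 ≤ masterN q (ThreeApex.swapBC z) := h.swapBC.masterN_nonneg hq0 hq1
  have hNac : 0 ≤ masterN q z := h.masterN_nonneg hq0 hq1
  have hzp : 0 < hz z := by simp only [hz]; linarith [hnn.hbc]
  have hxg : z.z0 ≤ hx z := by simp only [hx]; linarith [hnn.hab]
  have hyg : z.z0 ≤ hy z := by simp only [hy]; linarith [hnn.hac]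
  have hS : hx z * hz z ≤ z.z0 * z.total ∧ hy z * hz z ≤ z.z0 * z.total := by
    rcases h with ⟨ha0, ha1, hb0, hb1, hc0, hc1⟩ | ⟨hw0, hw1⟩ | ⟨hw0, hw1⟩ | ⟨hw0, hw1⟩
    · rename_i a b c
      have : 0 ≤ 1 - a := sub_nonneg.2 ha1
      have : 0 ≤ 1 - b := sub_nonneg.2 hb1
      have : 0 ≤ 1 - c := sub_nonneg.2 hc1
      have e1 : (ThreeApex.leaf q a b c).z0 * (ThreeApex.leaf q a b c).total - hx (ThreeApex.leaf q a b c) * hz (ThreeApex.leaf q a b c) =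
          a * c * (1 - b) * (q * (1 - a) * (1 - c) + a * (1 - c) + (1 - a) * b * (1 - c) + (1 - a) * c) := by
        simp only [ThreeApex.leaf, hx, hz, V5.total]; ring
      have e2 : (ThreeApex.leaf q a b c).z0 * (ThreeApex.leaf q a b c).total - hy (ThreeApex.leaf q a b c) * hz (ThreeApex.leaf q a b c) =
          a * b * (1 - c) * (q * (1 - a) * (1 - b) + a * (1 - b) + (1 - a) * c * (1 - b) + (1 - a) * b) := by
        simp only [ThreeApex.leaf, hy, hz, V5.total]; ring
      have r1 : 0 ≤ a * c * (1 - b) * (q * (1 - a) * (1 - c) + a * (1 - c) + (1 - a) * b * (1 - c) + (1 - a) * c) := by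
        positivity
      have r2 : 0 ≤ a * b * (1 - c) * (q * (1 - a) * (1 - b) + a * (1 - b) + (1 - a) * c * (1 - b) + (1 - a) * b) := by
        positivity
      constructor <;> linarith
    · rename_i w
      have : 0 ≤ 1 - w := sub_nonneg.2 hw1
      constructor <;> (simp only [ThreeApex.edgeAB, hx, hy, hz, V5.total]; nlinarith)
    · rename_i w
      have : 0 ≤ 1 - w := sub_nonneg.2 hw1
      constructor <;> (simp only [ThreeApex.edgeAC, hx, hy, hz, V5.total]; nlinarith)
    · rename_i w
      have : 0 ≤ 1 - w := sub_nonneg.2 hw1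
      constructor <;> (simp only [ThreeApex.edgeBC, hx, hy, hz, V5.total]; nlinarith)
  exact ⟨hu, hzp, hxg, hyg, hS.1, hS.2, hNab, hNac, hU⟩

end ThreeApex

end FK

end Summit.CriticalPhenomena.PercolationContinuityZ3.Theorems
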